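import Summits.CriticalPhenomena.PercolationContinuityZ3.Theorems.PercNearOneGluingNoHeavyLowerTailLocalizedExchangeCex
import HarnessLib

/-!
# `NoHeavyLowerTail` (stmt-CriticalPhenomena-4575) — hull-port line: the mirror-worlds inequality (SP) FAILS for a NON-relay marker
# (certified 7-vertex, 10-pair witness); for relay markers no violation is known

Support file (prover `prim-hp-7`, hull-port prover #7; `--supports stmt-CriticalPhenomena-4575`).  Computational (`native_decide` on 1 024-term exact
rational sums; evaluation lemma `LocalizedExchangeCex.real_Dp_inter` of the tree).  No definitions, no named facts, no sorries.

**Background.**  `HullPort.lsl_of_sp` (tree) derives hp-1's localized selection lemma LSL from the hypothesis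
  (SP)  `μ(D'∩G₋∩{x₁↔b}) · μ(D'∩G₊∩{x₂↔b}) ≤ μ(D'∩G₋∩{x₁↮b}) · μ(D'∩G₊∩{x₂↮b})`,
`D' = {z↮x₁}∩{z↮x₂}∩{x₁↮x₂}`, `G₋ = {|π(x₁)| ≤ j < |π(x₂)|}`, `G₊ = {|π(x₂)| ≤ j < |π(x₁)|}` ("the marker lies in the LIGHT cluster with probability at
most one half on average over the two mirror worlds").  The seat's census (run/shared/lean/prim/prim-hp-7/HP7-GX-FAMILY.md §2b–2d: ≈ 1.4·10⁵ ratio climbs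
at n = 7, exhaustive n = 6 at p = 1/2 — 4 227 072 checks) finds NO violation when the marker `b` is a ({3, 4, 6} : Finset (Fin 7))AY — the case used on the hull-port path, where `b` is
the candidate witness relay — but (kit job j051452, ratio climbs n = 7) violations with a NON-relay marker, in the "doubly glued marker" corner (b nearly glued
to both observers, its third neighbour nearly glued to x₁ and to the guard).

**This file: (SP) is false for a non-relay marker.**  Witness (simplified to ten pairs, relabelled to the frame of
`PercNearOneGluingNoHeavyLowerTailLocalizedExchangeCex.lean`): `Fin 7`, `x₂ = 0`, `x₁ = 6`, `z = 2`, marker `b = 5 ∉ A`, relays `A = {3,4,6}`, `j = 1`;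
weights `w(1,2) = 99/100`, `w(2,3) = 9/10`, `w(0,4) = 1/2`, `w(4,6) = 1/2`, `w(1,5) = 1/2`, `w(1,3) = 1/3`, `w(1,6) = 99/100`, `w(0,3) = 1/2`, `w(0,5) = 99/100`,
`w(5,6) = 99/100`, all other pairs `0`.  Exactly: `μ(D'∩G₋∩{6↔5}) = 19833/1.6·10¹⁰`, `μ(D'∩G₊∩{0↔5}) = 564301/4.8·10¹⁰`, `μ(D'∩G₋∩{6↮5}) = 13499/1.6·10¹⁰`,
`μ(D'∩G₊∩{0↮5}) = 32831/1.92·10⁹`; `P(b ∈ C(x₁) | D',G₋) + P(b ∈ C(x₂) | D',G₊) = 0.595 + 0.407 > 1` (margin `14017501/9.6·10¹⁹`).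
So `lsl_of_sp` must be fed (SP) for ({3, 4, 6} : Finset (Fin 7))AY markers (no violation known); LSL itself has no known violation for any marker.

* `MirrorWorldsFreeMarkerCex.cnt_reachTable` — relay counts for `A = {3,4,6}` read off reach tables;
* `MirrorWorldsFreeMarkerCex.violation_of_check` — one decidable rational fact ⇒ the violating instance;
* `mirrorWorlds_freeMarker_cex` — the instance;  `mirrorWorlds_freeMarker_false` — `¬`(SP for all markers), in the shape of `hSP` of `HullPort.lsl_of_sp`
  (with the conditioning set written as an intersection).
-/

namespace Summit.CriticalPhenomena.PercolationContinuityZ3.Theorems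

open MeasureTheory
open Literature.Probability.LatticeModels Literature.Probability.Percolation
open Summit.CriticalPhenomena.PercolationContinuityZ3.Theorems.AdditiveGluing.Negative.Cert
open scoped Classical

set_option maxHeartbeats 400000

namespace MirrorWorldsFreeMarkerCex

open LocalizedExchangeCex (real_Dp_inter)

/-- Relay counts for `A = {3,4,6}` read off the reach table of a configuration. [this file] -/
theorem cnt_reachTable (ω : List (Fin 7 × Fin 7)) (x : Fin 7) :
    ((({3, 4, 6} : Finset (Fin 7))).filter fun q : Fin 7 => ((reachTable 7 ω).getD x 0).testBit q.val = true).card =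
      (({3, 4, 6} : Finset (Fin 7)).filter fun q => (↑(Eset ω) : Set (Sym2 (Fin 7))) ∈ openConn x q).card := by
  congr 1
  exact Finset.filter_congr fun q _ => testBit_reachTable_iff_mem_openConn ω x q

/-- `μ(D' ∩ G₋ ∩ {6 ↔ 5})` (`x₁ = 6` light, `x₂ = 0` heavy, marker joined to `x₁`) as an exact weighted count. [this file] -/
theorem real_GmBt {l : List (Fin 7 × Fin 7 × ℚ)} (hnd : (wPairs l).Nodup) (hq : ∀ e ∈ l, 0 ≤ e.2.2 ∧ e.2.2 ≤ 1) :
    (prodBernoulli (wOfList l)).real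
        ({ω : BondConfig (Fin 7) | ¬ (openGraph ω).Reachable 2 6 ∧ ¬ (openGraph ω).Reachable 2 0 ∧
          ¬ (openGraph ω).Reachable 6 0} ∩
        {ω : BondConfig (Fin 7) | ((((({3, 4, 6} : Finset (Fin 7))).filter fun q => ω ∈ openConn 6 q).card) ≤ 1 ∧
          1 < ((({3, 4, 6} : Finset (Fin 7))).filter fun q => ω ∈ openConn 0 q).card) ∧ (openGraph ω).Reachable 6 5}) =
      (((((wtabs 7 l).map fun t => if ((!((t.1).getD 2 0).testBit 6 && !((t.1).getD 2 0).testBit 0 && !((t.1).getD 6 0).testBit 0) &&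
          (Nat.ble (((({3, 4, 6} : Finset (Fin 7)))).filter fun q : Fin 7 => ((t.1).getD 6 0).testBit q.val = true).card 1 &&
           Nat.blt 1 (((({3, 4, 6} : Finset (Fin 7)))).filter fun q : Fin 7 => ((t.1).getD 0 0).testBit q.val = true).card &&
           (t.1.getD 6 0).testBit 5)) then t.2 else 0).sum) : ℚ) : ℝ) :=
  real_Dp_inter hnd hq (fun tb => Nat.ble (((({3, 4, 6} : Finset (Fin 7)))).filter fun q : Fin 7 => ((tb).getD 6 0).testBit q.val = true).card 1 &&
           Nat.blt 1 (((({3, 4, 6} : Finset (Fin 7)))).filter fun q : Fin 7 => ((tb).getD 0 0).testBit q.val = true).card &&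
           (tb.getD 6 0).testBit 5)
    {ω : BondConfig (Fin 7) | ((((({3, 4, 6} : Finset (Fin 7))).filter fun q => ω ∈ openConn 6 q).card) ≤ 1 ∧
          1 < ((({3, 4, 6} : Finset (Fin 7))).filter fun q => ω ∈ openConn 0 q).card) ∧ (openGraph ω).Reachable 6 5} fun ω => by
    have hb : ((reachTable 7 ω).getD 6 0).testBit 5 = true ↔ (↑(Eset ω) : Set (Sym2 (Fin 7))) ∈ openConn (6 : Fin 7) (5 : Fin 7) :=
      testBit_reachTable_iff_mem_openConn ω (6 : Fin 7) (5 : Fin 7)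
    have hc6 : (((({3, 4, 6} : Finset (Fin 7)))).filter fun q : Fin 7 => (((reachTable 7 ω)).getD 6 0).testBit q.val = true).card =
        ((({3, 4, 6} : Finset (Fin 7))).filter fun q => (↑(Eset ω) : Set (Sym2 (Fin 7))) ∈ openConn 6 q).card := cnt_reachTable ω 6
    have hc0 : (((({3, 4, 6} : Finset (Fin 7)))).filter fun q : Fin 7 => (((reachTable 7 ω)).getD 0 0).testBit q.val = true).card =
        ((({3, 4, 6} : Finset (Fin 7))).filter fun q => (↑(Eset ω) : Set (Sym2 (Fin 7))) ∈ openConn 0 q).card := cnt_reachTable ω 0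
    rw [Bool.and_eq_true, Bool.and_eq_true, Nat.ble_eq, Nat.blt_eq, hc6, hc0, Set.mem_setOf_eq]
    exact ⟨fun ⟨⟨h1, h2⟩, h3⟩ => ⟨⟨h1, h2⟩, hb.1 h3⟩, fun ⟨⟨h1, h2⟩, h3⟩ => ⟨⟨h1, h2⟩, hb.2 h3⟩⟩

/-- `μ(D' ∩ G₊ ∩ {0 ↔ 5})` (`x₂ = 0` light, `x₁ = 6` heavy, marker joined to `x₂`) as an exact weighted count. [this file] -/
theorem real_GpBs {l : List (Fin 7 × Fin 7 × ℚ)} (hnd : (wPairs l).Nodup) (hq : ∀ e ∈ l, 0 ≤ e.2.2 ∧ e.2.2 ≤ 1) :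
    (prodBernoulli (wOfList l)).real
        ({ω : BondConfig (Fin 7) | ¬ (openGraph ω).Reachable 2 6 ∧ ¬ (openGraph ω).Reachable 2 0 ∧
          ¬ (openGraph ω).Reachable 6 0} ∩
        {ω : BondConfig (Fin 7) | ((((({3, 4, 6} : Finset (Fin 7))).filter fun q => ω ∈ openConn 0 q).card) ≤ 1 ∧
          1 < ((({3, 4, 6} : Finset (Fin 7))).filter fun q => ω ∈ openConn 6 q).card) ∧ (openGraph ω).Reachable 0 5}) =
      (((((wtabs 7 l).map fun t => if ((!((t.1).getD 2 0).testBit 6 && !((t.1).getD 2 0).testBit 0 && !((t.1).getD 6 0).testBit 0) &&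
          (Nat.ble (((({3, 4, 6} : Finset (Fin 7)))).filter fun q : Fin 7 => ((t.1).getD 0 0).testBit q.val = true).card 1 &&
           Nat.blt 1 (((({3, 4, 6} : Finset (Fin 7)))).filter fun q : Fin 7 => ((t.1).getD 6 0).testBit q.val = true).card &&
           (t.1.getD 0 0).testBit 5)) then t.2 else 0).sum) : ℚ) : ℝ) :=
  real_Dp_inter hnd hq (fun tb => Nat.ble (((({3, 4, 6} : Finset (Fin 7)))).filter fun q : Fin 7 => ((tb).getD 0 0).testBit q.val = true).card 1 &&
           Nat.blt 1 (((({3, 4, 6} : Finset (Fin 7)))).filter fun q : Fin 7 => ((tb).getD 6 0).testBit q.val = true).card &&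
           (tb.getD 0 0).testBit 5)
    {ω : BondConfig (Fin 7) | ((((({3, 4, 6} : Finset (Fin 7))).filter fun q => ω ∈ openConn 0 q).card) ≤ 1 ∧
          1 < ((({3, 4, 6} : Finset (Fin 7))).filter fun q => ω ∈ openConn 6 q).card) ∧ (openGraph ω).Reachable 0 5} fun ω => by
    have hb : ((reachTable 7 ω).getD 0 0).testBit 5 = true ↔ (↑(Eset ω) : Set (Sym2 (Fin 7))) ∈ openConn (0 : Fin 7) (5 : Fin 7) :=
      testBit_reachTable_iff_mem_openConn ω (0 : Fin 7) (5 : Fin 7)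
    have hc6 : (((({3, 4, 6} : Finset (Fin 7)))).filter fun q : Fin 7 => (((reachTable 7 ω)).getD 6 0).testBit q.val = true).card =
        ((({3, 4, 6} : Finset (Fin 7))).filter fun q => (↑(Eset ω) : Set (Sym2 (Fin 7))) ∈ openConn 6 q).card := cnt_reachTable ω 6
    have hc0 : (((({3, 4, 6} : Finset (Fin 7)))).filter fun q : Fin 7 => (((reachTable 7 ω)).getD 0 0).testBit q.val = true).card =
        ((({3, 4, 6} : Finset (Fin 7))).filter fun q => (↑(Eset ω) : Set (Sym2 (Fin 7))) ∈ openConn 0 q).card := cnt_reachTable ω 0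
    rw [Bool.and_eq_true, Bool.and_eq_true, Nat.ble_eq, Nat.blt_eq, hc0, hc6, Set.mem_setOf_eq]
    exact ⟨fun ⟨⟨h1, h2⟩, h3⟩ => ⟨⟨h1, h2⟩, hb.1 h3⟩, fun ⟨⟨h1, h2⟩, h3⟩ => ⟨⟨h1, h2⟩, hb.2 h3⟩⟩

/-- `μ(D' ∩ G₋ ∩ {6 ↮ 5})` as an exact weighted count. [this file] -/
theorem real_GmNbt {l : List (Fin 7 × Fin 7 × ℚ)} (hnd : (wPairs l).Nodup) (hq : ∀ e ∈ l, 0 ≤ e.2.2 ∧ e.2.2 ≤ 1) :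
    (prodBernoulli (wOfList l)).real
        ({ω : BondConfig (Fin 7) | ¬ (openGraph ω).Reachable 2 6 ∧ ¬ (openGraph ω).Reachable 2 0 ∧
          ¬ (openGraph ω).Reachable 6 0} ∩
        {ω : BondConfig (Fin 7) | ((((({3, 4, 6} : Finset (Fin 7))).filter fun q => ω ∈ openConn 6 q).card) ≤ 1 ∧
          1 < ((({3, 4, 6} : Finset (Fin 7))).filter fun q => ω ∈ openConn 0 q).card) ∧ ¬ (openGraph ω).Reachable 6 5}) =
      (((((wtabs 7 l).map fun t => if ((!((t.1).getD 2 0).testBit 6 && !((t.1).getD 2 0).testBit 0 && !((t.1).getD 6 0).testBit 0) &&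
          (Nat.ble (((({3, 4, 6} : Finset (Fin 7)))).filter fun q : Fin 7 => ((t.1).getD 6 0).testBit q.val = true).card 1 &&
           Nat.blt 1 (((({3, 4, 6} : Finset (Fin 7)))).filter fun q : Fin 7 => ((t.1).getD 0 0).testBit q.val = true).card &&
           !(t.1.getD 6 0).testBit 5)) then t.2 else 0).sum) : ℚ) : ℝ) :=
  real_Dp_inter hnd hq (fun tb => Nat.ble (((({3, 4, 6} : Finset (Fin 7)))).filter fun q : Fin 7 => ((tb).getD 6 0).testBit q.val = true).card 1 &&
           Nat.blt 1 (((({3, 4, 6} : Finset (Fin 7)))).filter fun q : Fin 7 => ((tb).getD 0 0).testBit q.val = true).card &&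
           !(tb.getD 6 0).testBit 5)
    {ω : BondConfig (Fin 7) | ((((({3, 4, 6} : Finset (Fin 7))).filter fun q => ω ∈ openConn 6 q).card) ≤ 1 ∧
          1 < ((({3, 4, 6} : Finset (Fin 7))).filter fun q => ω ∈ openConn 0 q).card) ∧ ¬ (openGraph ω).Reachable 6 5} fun ω => by
    have hb : ((reachTable 7 ω).getD 6 0).testBit 5 = true ↔ (↑(Eset ω) : Set (Sym2 (Fin 7))) ∈ openConn (6 : Fin 7) (5 : Fin 7) :=
      testBit_reachTable_iff_mem_openConn ω (6 : Fin 7) (5 : Fin 7)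
    have hc6 : (((({3, 4, 6} : Finset (Fin 7)))).filter fun q : Fin 7 => (((reachTable 7 ω)).getD 6 0).testBit q.val = true).card =
        ((({3, 4, 6} : Finset (Fin 7))).filter fun q => (↑(Eset ω) : Set (Sym2 (Fin 7))) ∈ openConn 6 q).card := cnt_reachTable ω 6
    have hc0 : (((({3, 4, 6} : Finset (Fin 7)))).filter fun q : Fin 7 => (((reachTable 7 ω)).getD 0 0).testBit q.val = true).card =
        ((({3, 4, 6} : Finset (Fin 7))).filter fun q => (↑(Eset ω) : Set (Sym2 (Fin 7))) ∈ openConn 0 q).card := cnt_reachTable ω 0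
    rw [Bool.and_eq_true, Bool.and_eq_true, Nat.ble_eq, Nat.blt_eq, hc6, hc0, Set.mem_setOf_eq, Bool.not_eq_true']
    constructor
    · rintro ⟨⟨h1, h2⟩, h3⟩
      exact ⟨⟨h1, h2⟩, fun h => by rw [hb.2 h] at h3; exact Bool.noConfusion h3⟩
    · rintro ⟨⟨h1, h2⟩, h3⟩
      refine ⟨⟨h1, h2⟩, ?_⟩
      cases h : ((reachTable 7 ω).getD 6 0).testBit 5
      · rfl
      · exact absurd (hb.1 h) h3

/-- `μ(D' ∩ G₊ ∩ {0 ↮ 5})` as an exact weighted count. [this file] -/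
theorem real_GpNbs {l : List (Fin 7 × Fin 7 × ℚ)} (hnd : (wPairs l).Nodup) (hq : ∀ e ∈ l, 0 ≤ e.2.2 ∧ e.2.2 ≤ 1) :
    (prodBernoulli (wOfList l)).real
        ({ω : BondConfig (Fin 7) | ¬ (openGraph ω).Reachable 2 6 ∧ ¬ (openGraph ω).Reachable 2 0 ∧
          ¬ (openGraph ω).Reachable 6 0} ∩
        {ω : BondConfig (Fin 7) | ((((({3, 4, 6} : Finset (Fin 7))).filter fun q => ω ∈ openConn 0 q).card) ≤ 1 ∧
          1 < ((({3, 4, 6} : Finset (Fin 7))).filter fun q => ω ∈ openConn 6 q).card) ∧ ¬ (openGraph ω).Reachable 0 5}) =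
      (((((wtabs 7 l).map fun t => if ((!((t.1).getD 2 0).testBit 6 && !((t.1).getD 2 0).testBit 0 && !((t.1).getD 6 0).testBit 0) &&
          (Nat.ble (((({3, 4, 6} : Finset (Fin 7)))).filter fun q : Fin 7 => ((t.1).getD 0 0).testBit q.val = true).card 1 &&
           Nat.blt 1 (((({3, 4, 6} : Finset (Fin 7)))).filter fun q : Fin 7 => ((t.1).getD 6 0).testBit q.val = true).card &&
           !(t.1.getD 0 0).testBit 5)) then t.2 else 0).sum) : ℚ) : ℝ) :=
  real_Dp_inter hnd hq (fun tb => Nat.ble (((({3, 4, 6} : Finset (Fin 7)))).filter fun q : Fin 7 => ((tb).getD 0 0).testBit q.val = true).card 1 &&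
           Nat.blt 1 (((({3, 4, 6} : Finset (Fin 7)))).filter fun q : Fin 7 => ((tb).getD 6 0).testBit q.val = true).card &&
           !(tb.getD 0 0).testBit 5)
    {ω : BondConfig (Fin 7) | ((((({3, 4, 6} : Finset (Fin 7))).filter fun q => ω ∈ openConn 0 q).card) ≤ 1 ∧
          1 < ((({3, 4, 6} : Finset (Fin 7))).filter fun q => ω ∈ openConn 6 q).card) ∧ ¬ (openGraph ω).Reachable 0 5} fun ω => by
    have hb : ((reachTable 7 ω).getD 0 0).testBit 5 = true ↔ (↑(Eset ω) : Set (Sym2 (Fin 7))) ∈ openConn (0 : Fin 7) (5 : Fin 7) :=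
      testBit_reachTable_iff_mem_openConn ω (0 : Fin 7) (5 : Fin 7)
    have hc6 : (((({3, 4, 6} : Finset (Fin 7)))).filter fun q : Fin 7 => (((reachTable 7 ω)).getD 6 0).testBit q.val = true).card =
        ((({3, 4, 6} : Finset (Fin 7))).filter fun q => (↑(Eset ω) : Set (Sym2 (Fin 7))) ∈ openConn 6 q).card := cnt_reachTable ω 6
    have hc0 : (((({3, 4, 6} : Finset (Fin 7)))).filter fun q : Fin 7 => (((reachTable 7 ω)).getD 0 0).testBit q.val = true).card =
        ((({3, 4, 6} : Finset (Fin 7))).filter fun q => (↑(Eset ω) : Set (Sym2 (Fin 7))) ∈ openConn 0 q).card := cnt_reachTable ω 0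
    rw [Bool.and_eq_true, Bool.and_eq_true, Nat.ble_eq, Nat.blt_eq, hc0, hc6, Set.mem_setOf_eq, Bool.not_eq_true']
    constructor
    · rintro ⟨⟨h1, h2⟩, h3⟩
      exact ⟨⟨h1, h2⟩, fun h => by rw [hb.2 h] at h3; exact Bool.noConfusion h3⟩
    · rintro ⟨⟨h1, h2⟩, h3⟩
      refine ⟨⟨h1, h2⟩, ?_⟩
      cases h : ((reachTable 7 ω).getD 0 0).testBit 5
      · rfl
      · exact absurd (hb.1 h) h3

/-- **From one checkable rational fact to the violating instance** of (SP) on `Fin 7` (`x₂ = 0`, `x₁ = 6`, `z = 2`, `b = 5`, relays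
`{3,4,6}`, `j = 1`). [this file] -/
theorem violation_of_check (l : List (Fin 7 × Fin 7 × ℚ)) (hnd : (wPairs l).Nodup)
    (hq : ∀ e ∈ l, 0 ≤ e.2.2 ∧ e.2.2 ≤ 1)
    (hlt : ((wtabs 7 l).map fun t => if ((!((t.1).getD 2 0).testBit 6 && !((t.1).getD 2 0).testBit 0 && !((t.1).getD 6 0).testBit 0) &&
          (Nat.ble (((({3, 4, 6} : Finset (Fin 7)))).filter fun q : Fin 7 => ((t.1).getD 6 0).testBit q.val = true).card 1 &&
           Nat.blt 1 (((({3, 4, 6} : Finset (Fin 7)))).filter fun q : Fin 7 => ((t.1).getD 0 0).testBit q.val = true).card &&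
           !(t.1.getD 6 0).testBit 5)) then t.2 else 0).sum *
        ((wtabs 7 l).map fun t => if ((!((t.1).getD 2 0).testBit 6 && !((t.1).getD 2 0).testBit 0 && !((t.1).getD 6 0).testBit 0) &&
          (Nat.ble (((({3, 4, 6} : Finset (Fin 7)))).filter fun q : Fin 7 => ((t.1).getD 0 0).testBit q.val = true).card 1 &&
           Nat.blt 1 (((({3, 4, 6} : Finset (Fin 7)))).filter fun q : Fin 7 => ((t.1).getD 6 0).testBit q.val = true).card &&
           !(t.1.getD 0 0).testBit 5)) then t.2 else 0).sum <
      ((wtabs 7 l).map fun t => if ((!((t.1).getD 2 0).testBit 6 && !((t.1).getD 2 0).testBit 0 && !((t.1).getD 6 0).testBit 0) &&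
          (Nat.ble (((({3, 4, 6} : Finset (Fin 7)))).filter fun q : Fin 7 => ((t.1).getD 6 0).testBit q.val = true).card 1 &&
           Nat.blt 1 (((({3, 4, 6} : Finset (Fin 7)))).filter fun q : Fin 7 => ((t.1).getD 0 0).testBit q.val = true).card &&
           (t.1.getD 6 0).testBit 5)) then t.2 else 0).sum *
        ((wtabs 7 l).map fun t => if ((!((t.1).getD 2 0).testBit 6 && !((t.1).getD 2 0).testBit 0 && !((t.1).getD 6 0).testBit 0) &&
          (Nat.ble (((({3, 4, 6} : Finset (Fin 7)))).filter fun q : Fin 7 => ((t.1).getD 0 0).testBit q.val = true).card 1 &&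
           Nat.blt 1 (((({3, 4, 6} : Finset (Fin 7)))).filter fun q : Fin 7 => ((t.1).getD 6 0).testBit q.val = true).card &&
           (t.1.getD 0 0).testBit 5)) then t.2 else 0).sum) :
    (prodBernoulli (wOfList l)).real
        ({ω : BondConfig (Fin 7) | ¬ (openGraph ω).Reachable 2 6 ∧ ¬ (openGraph ω).Reachable 2 0 ∧
          ¬ (openGraph ω).Reachable 6 0} ∩
        {ω : BondConfig (Fin 7) | ((((({3, 4, 6} : Finset (Fin 7))).filter fun q => ω ∈ openConn 6 q).card) ≤ 1 ∧
          1 < ((({3, 4, 6} : Finset (Fin 7))).filter fun q => ω ∈ openConn 0 q).card) ∧ ¬ (openGraph ω).Reachable 6 5}) *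
      (prodBernoulli (wOfList l)).real
        ({ω : BondConfig (Fin 7) | ¬ (openGraph ω).Reachable 2 6 ∧ ¬ (openGraph ω).Reachable 2 0 ∧
          ¬ (openGraph ω).Reachable 6 0} ∩
        {ω : BondConfig (Fin 7) | ((((({3, 4, 6} : Finset (Fin 7))).filter fun q => ω ∈ openConn 0 q).card) ≤ 1 ∧
          1 < ((({3, 4, 6} : Finset (Fin 7))).filter fun q => ω ∈ openConn 6 q).card) ∧ ¬ (openGraph ω).Reachable 0 5}) <
    (prodBernoulli (wOfList l)).real
        ({ω : BondConfig (Fin 7) | ¬ (openGraph ω).Reachable 2 6 ∧ ¬ (openGraph ω).Reachable 2 0 ∧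
          ¬ (openGraph ω).Reachable 6 0} ∩
        {ω : BondConfig (Fin 7) | ((((({3, 4, 6} : Finset (Fin 7))).filter fun q => ω ∈ openConn 6 q).card) ≤ 1 ∧
          1 < ((({3, 4, 6} : Finset (Fin 7))).filter fun q => ω ∈ openConn 0 q).card) ∧ (openGraph ω).Reachable 6 5}) *
      (prodBernoulli (wOfList l)).real
        ({ω : BondConfig (Fin 7) | ¬ (openGraph ω).Reachable 2 6 ∧ ¬ (openGraph ω).Reachable 2 0 ∧
          ¬ (openGraph ω).Reachable 6 0} ∩
        {ω : BondConfig (Fin 7) | ((((({3, 4, 6} : Finset (Fin 7))).filter fun q => ω ∈ openConn 0 q).card) ≤ 1 ∧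
          1 < ((({3, 4, 6} : Finset (Fin 7))).filter fun q => ω ∈ openConn 6 q).card) ∧ (openGraph ω).Reachable 0 5}) := by
  rw [real_GmNbt hnd hq, real_GpNbs hnd hq, real_GmBt hnd hq, real_GpBs hnd hq]
  exact_mod_cast hlt

end MirrorWorldsFreeMarkerCex

open MirrorWorldsFreeMarkerCex in
/-- **(SP) fails for a non-relay marker: the instance** (weights in the module docstring;
`(13499/1.6e10)·(32831/1.92e9) < (19833/1.6e10)·(564301/4.8e10)`, exact rationals by `native_decide`). [this file] -/
theorem mirrorWorlds_freeMarker_cex : ∃ w : Sym2 (Fin 7) → unitInterval,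
    (prodBernoulli w).real
        ({ω : BondConfig (Fin 7) | ¬ (openGraph ω).Reachable 2 6 ∧ ¬ (openGraph ω).Reachable 2 0 ∧
          ¬ (openGraph ω).Reachable 6 0} ∩
        {ω : BondConfig (Fin 7) | ((((({3, 4, 6} : Finset (Fin 7))).filter fun q => ω ∈ openConn 6 q).card) ≤ 1 ∧
          1 < ((({3, 4, 6} : Finset (Fin 7))).filter fun q => ω ∈ openConn 0 q).card) ∧ ¬ (openGraph ω).Reachable 6 5}) *
      (prodBernoulli w).real
        ({ω : BondConfig (Fin 7) | ¬ (openGraph ω).Reachable 2 6 ∧ ¬ (openGraph ω).Reachable 2 0 ∧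
          ¬ (openGraph ω).Reachable 6 0} ∩
        {ω : BondConfig (Fin 7) | ((((({3, 4, 6} : Finset (Fin 7))).filter fun q => ω ∈ openConn 0 q).card) ≤ 1 ∧
          1 < ((({3, 4, 6} : Finset (Fin 7))).filter fun q => ω ∈ openConn 6 q).card) ∧ ¬ (openGraph ω).Reachable 0 5}) <
    (prodBernoulli w).real
        ({ω : BondConfig (Fin 7) | ¬ (openGraph ω).Reachable 2 6 ∧ ¬ (openGraph ω).Reachable 2 0 ∧
          ¬ (openGraph ω).Reachable 6 0} ∩
        {ω : BondConfig (Fin 7) | ((((({3, 4, 6} : Finset (Fin 7))).filter fun q => ω ∈ openConn 6 q).card) ≤ 1 ∧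
          1 < ((({3, 4, 6} : Finset (Fin 7))).filter fun q => ω ∈ openConn 0 q).card) ∧ (openGraph ω).Reachable 6 5}) *
      (prodBernoulli w).real
        ({ω : BondConfig (Fin 7) | ¬ (openGraph ω).Reachable 2 6 ∧ ¬ (openGraph ω).Reachable 2 0 ∧
          ¬ (openGraph ω).Reachable 6 0} ∩
        {ω : BondConfig (Fin 7) | ((((({3, 4, 6} : Finset (Fin 7))).filter fun q => ω ∈ openConn 0 q).card) ≤ 1 ∧
          1 < ((({3, 4, 6} : Finset (Fin 7))).filter fun q => ω ∈ openConn 6 q).card) ∧ (openGraph ω).Reachable 0 5}) :=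
  ⟨_, violation_of_check
    [(1, 2, 99/100), (2, 3, 9/10), (0, 4, 1/2), (4, 6, 1/2), (1, 5, 1/2), (1, 3, 1/3), (1, 6, 99/100), (0, 3, 1/2), (0, 5, 99/100),
      (5, 6, 99/100)]
    (by decide)
    (by
      intro e he
      simp only [List.mem_cons, List.not_mem_nil, or_false] at he
      rcases he with rfl | rfl | rfl | rfl | rfl | rfl | rfl | rfl | rfl | rfl <;> norm_num)
    (by native_decide)⟩

/-- **No-go: the mirror-worlds inequality (SP) does NOT hold for every marker.**  It is false that for every finite weighted graph, relay set `A`,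
level `j` and distinct `x₁, x₂, z, b`,
`μ(D'∩G₋∩{x₁↔b})·μ(D'∩G₊∩{x₂↔b}) ≤ μ(D'∩G₋∩{x₁↮b})·μ(D'∩G₊∩{x₂↮b})` (`D'`, `G₋`, `G₊` as in the module docstring); the witness
`mirrorWorlds_freeMarker_cex` has a NON-relay marker (`b = 5 ∉ A = {3,4,6}`).  No violation is known when `b ∈ A`. [this file] -/
theorem mirrorWorlds_freeMarker_false :
    ¬ (∀ (n : ℕ) (w : Sym2 (Fin n) → unitInterval) (A : Finset (Fin n)) (j : ℕ) (x₁ x₂ z b : Fin n), [x₁, x₂, z, b].Nodup →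
      (prodBernoulli w).real
          ({ω : BondConfig (Fin n) | ¬ (openGraph ω).Reachable z x₁ ∧ ¬ (openGraph ω).Reachable z x₂ ∧
            ¬ (openGraph ω).Reachable x₁ x₂} ∩
          {ω : BondConfig (Fin n) | ((A.filter fun q => ω ∈ openConn x₁ q).card ≤ j ∧
            j < (A.filter fun q => ω ∈ openConn x₂ q).card) ∧ (openGraph ω).Reachable x₁ b}) *
        (prodBernoulli w).real
          ({ω : BondConfig (Fin n) | ¬ (openGraph ω).Reachable z x₁ ∧ ¬ (openGraph ω).Reachable z x₂ ∧
            ¬ (openGraph ω).Reachable x₁ x₂} ∩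
          {ω : BondConfig (Fin n) | ((A.filter fun q => ω ∈ openConn x₂ q).card ≤ j ∧
            j < (A.filter fun q => ω ∈ openConn x₁ q).card) ∧ (openGraph ω).Reachable x₂ b}) ≤
      (prodBernoulli w).real
          ({ω : BondConfig (Fin n) | ¬ (openGraph ω).Reachable z x₁ ∧ ¬ (openGraph ω).Reachable z x₂ ∧
            ¬ (openGraph ω).Reachable x₁ x₂} ∩
          {ω : BondConfig (Fin n) | ((A.filter fun q => ω ∈ openConn x₁ q).card ≤ j ∧
            j < (A.filter fun q => ω ∈ openConn x₂ q).card) ∧ ¬ (openGraph ω).Reachable x₁ b}) *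
        (prodBernoulli w).real
          ({ω : BondConfig (Fin n) | ¬ (openGraph ω).Reachable z x₁ ∧ ¬ (openGraph ω).Reachable z x₂ ∧
            ¬ (openGraph ω).Reachable x₁ x₂} ∩
          {ω : BondConfig (Fin n) | ((A.filter fun q => ω ∈ openConn x₂ q).card ≤ j ∧
            j < (A.filter fun q => ω ∈ openConn x₁ q).card) ∧ ¬ (openGraph ω).Reachable x₂ b})) := by
  intro h
  obtain ⟨w, hgt⟩ := mirrorWorlds_freeMarker_cex
  have hle := h 7 w ({3, 4, 6} : Finset (Fin 7)) 1 6 0 2 5 (by decide)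
  exact absurd hle (not_le.2 hgt)

end Summit.CriticalPhenomena.PercolationContinuityZ3.Theorems
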